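import Summits.SmoothPoincare4.SmoothPoincare4.Theses.SullivanDual
import Summits.SmoothPoincare4.SmoothPoincare4.Theses.SymplecticCap
import Literature.Geometry.Symplectic.GromovMcDuffTwistedSphereProofs
import HarnessLib

/-!
# `SympcapGlueChartStandardEnd` (item stmt-SmoothPoincare4-0443): a diffeomorphism
# `Σ ∖ p ≃ₘ ℝ⁴` standard near the puncture extends over `p` to `Σ ≅ S⁴`

Shared support item of routes `SmoothPoincare4/SullivanDual` and `SmoothPoincare4/SymplecticCap`
(the two route decls are verbatim equal): for a homotopy 4-sphere `Σ`, `p ∈ Σ` and a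
diffeomorphism `Φ : Σ ∖ {p} ≃ₘ ℝ⁴` which on a punctured chart-ball about `p` equals the inverted
recentred chart `ι ∘ (e − e p)`, `ι z = (‖z‖²)⁻¹ • z`, `e = extChartAt (𝓡 4) p`, the manifold `Σ` is
diffeomorphic to `S⁴`.

The mathematics is already in `Literature/Geometry/Symplectic/GromovMcDuffTwistedSphereProofs`
(`Literature.Geometry.Symplectic.sympcap_glue_chartStandardEnd`: both `Σ` and `S⁴` are the double
`D⁴ ∪_{id} D⁴` — the two discs being the closed chart-ball and `Φ⁻¹` of a large closed ball — and
the gluing of two discs along the same map is unique up to diffeomorphism, Hirsch 1976 Ch. 8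
Thm. 2.1; no Cerf, no Palais). The route statement is that Literature statement with
`Literature.Geometry.Symplectic.punctured p = ⟨{p}ᶜ, _⟩`,
`Literature.Geometry.Symplectic.AgreesWithInvertedChartNear` and
`Literature.Geometry.Symplectic.inversion` δ-unfolded, so each proof is a direct term.
Unconditional (no named facts).
-/

-- the prescribed namespace `Summit.<P>.<Sub>.…` duplicates `SmoothPoincare4` (P = Sub)
set_option linter.dupNamespace false

namespace Summit.SmoothPoincare4.SmoothPoincare4.Theorems

/-- Settles item stmt-SmoothPoincare4-0443 for route `SullivanDual`: a diffeomorphism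
`Σ ∖ {p} ≃ₘ ℝ⁴` equal to the inverted recentred chart on a punctured chart-ball at `p` gives
`Σ ≃ₘ S⁴` (double of two discs + uniqueness of gluing, via
`Literature.Geometry.Symplectic.sympcap_glue_chartStandardEnd`). [folklore] -/
theorem sympcapGlueChartStandardEnd_proof :
    Summit.SmoothPoincare4.SmoothPoincare4.Theses.SullivanDual.SympcapGlueChartStandardEnd := by
  unfold Summit.SmoothPoincare4.SmoothPoincare4.Theses.SullivanDual.SympcapGlueChartStandardEnd
  intro S p Φ hΦ
  exact Literature.Geometry.Symplectic.sympcap_glue_chartStandardEnd S p Φ hΦ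

/-- The same item stmt-SmoothPoincare4-0443 as filed in route `SymplecticCap` (verbatim equal
route decl): a diffeomorphism `Σ ∖ {p} ≃ₘ ℝ⁴` standard near `p` gives `Σ ≃ₘ S⁴`. [folklore] -/
theorem sympcapGlueChartStandardEnd_proof_symplecticCap :
    Summit.SmoothPoincare4.SmoothPoincare4.Theses.SymplecticCap.SympcapGlueChartStandardEnd := by
  unfold Summit.SmoothPoincare4.SmoothPoincare4.Theses.SymplecticCap.SympcapGlueChartStandardEnd
  intro S p Φ hΦ
  exact Literature.Geometry.Symplectic.sympcap_glue_chartStandardEnd S p Φ hΦ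

end Summit.SmoothPoincare4.SmoothPoincare4.Theorems
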